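import Literature.NumberTheory.Sieve.RamanujanSum
import Mathlib.NumberTheory.ZetaValues
import Mathlib.Analysis.Real.Pi.Bounds
import HarnessLib

/-!
# Conrey–Iwaniec (2002) §4, (4.32): the constant `ζ_q(2)/ζ(2) = Σ_{(e,q)=1} μ(e) e⁻²` and its
# Euler-factor recursion

B. Conrey, H. Iwaniec, *Spacing of zeros of Hecke L-functions and the class number problem*,
Acta Arith. 103 (2002) 259–312, §4 (4.32) [held text `paper:arxiv-math_0111012`, p0012–p0013].
First of three arithmetic toolkit files for the registered stub S3e `stub_sigma_genus` of the
line `theta-circle-method` (cell `landau-siegel/ls-inputs`; the main-term coefficients `σ(h)` of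
the genus Eisenstein series satisfy `IsCISigma`). Everything here is PROVED (plumbing definitions
with bodies — `msTerm`, `moebiusSqSum`, `jFun`, `kFun`, `mFun`, `rcSum`, all the definitions of
the S3e toolkit, so that the sequel files are theorem-only — and theorems).

* `msTerm m e = [(e,m)=1] μ(e) e⁻²`, `moebiusSqSum m = Σ_e msTerm m e` — for `m = q` this is the
  constant `ζ_q(2)/ζ(2) = ∏_{p ∤ q}(1 − p⁻²)` of (4.32) (we never need the Euler product, only:)
* `moebiusSqSum_eq_mul_prime` — removing one Euler factor: for a prime `p ∤ m`,
  `Σ_{(e,m)=1} μ(e)e⁻² = (1 − p⁻²)·Σ_{(e,mp)=1} μ(e)e⁻²` (split `e` by `p ∣ e`, substitute `e = pe'`);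
  `moebiusSqSum_eq_prod_mul`, `moebiusSqSum_div_eq` — the same for a finite set of primes / for
  `q/a ↦ q`, `a ∣ q` squarefree: `Σ_{(e,q/a)=1} = ∏_{p∣a}(1 − p⁻²)·Σ_{(e,q)=1}`;
* `moebiusSqSum_nonneg`, `moebiusSqSum_le_one` — **`0 ≤ Σ_{(e,m)=1} μ(e)e⁻² ≤ 1` for odd `m`**
  (head `1 − 1/4 − [3∤m]/9`, tail `|Σ_{e≥5}| ≤ Σ_{e≥5} e⁻² = π²/6 − 1 − 1/4 − 1/9 − 1/16 < 1/4`,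
  Mathlib `hasSum_zeta_two`, `Real.pi_lt_d2`); this is the `0 ≤ κ ≤ 1` of the tree's `IsCISigma`;
* small Möbius lemmas on squarefree numbers (`moebius_mul_eq`, `moebius_mul_moebius_of_dvd`,
  `prod_one_sub_sq_eq`: `∏_{p∣a}(1 − p²) = μ(a)a²∏_{p∣a}(1 − p⁻²)`), the reindexing
  `Σ_{c : d∣c} G(c) = Σ_e G(de)` (`tsum_ite_dvd_eq`);
* DEFINITIONS for the sequel (`ConreyIwaniec2002SigmaRamanujan.lean`, (4.27)–(4.32)):
  `jFun w = n ↦ [(n,w)=1] n⁻¹`, `kFun v = n ↦ [n∣v] μ(n) n`, `mFun v w = ζ * jFun w * kFun v`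
  (arithmetic functions over `ℝ`), and `rcSum q v h = Σ_{c ≥ 1, (c,q)=v} r_c(h) c⁻²`, the series of
  (4.27) with `r_c(h)` in Kluyver's form `Σ_{d∣(c,h)} dμ(c/d)` (the tree's `ramanujanDivisorSum`).

«The programme SEARCHES and TYPES; no claim about Landau–Siegel zeros, Theorems 1–2 of
arXiv:2211.02515 or a repaired Margin232 until a kernel theorem says so.»
-/

noncomputable section

open scoped ArithmeticFunction.Moebius ArithmeticFunction.zeta
open Finset ArithmeticFunction Literature.NumberTheory.Sieve

namespace Literature.NumberTheory.LFunctions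

namespace ConreyIwaniec2002

namespace SigmaGenus

/-! ### Reindexing a series over the multiples of `d` -/

/-- `Σ_{c : d ∣ c} G(c) = Σ_e G(de)` for `d ≠ 0` (the substitution `c = de` of (4.28)–(4.31)).
[cite: ConreyIwaniec2002, §4 (4.28)–(4.31)] -/
theorem tsum_ite_dvd_eq (d : ℕ) (hd : d ≠ 0) (G : ℕ → ℝ) :
    ∑' c : ℕ, (if d ∣ c then G c else 0) = ∑' e : ℕ, G (d * e) := by
  have hinj : Function.Injective (fun e : ℕ ↦ d * e) := mul_right_injective₀ hd
  have h := hinj.tsum_eq (f := fun c : ℕ ↦ if d ∣ c then G c else 0) (by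
    intro c hc
    rw [Function.mem_support] at hc
    by_cases hdc : d ∣ c
    · obtain ⟨e, rfl⟩ := hdc
      exact ⟨e, rfl⟩
    · exact absurd (if_neg hdc) hc)
  rw [← h]
  exact tsum_congr fun e ↦ by simp only [dvd_mul_right, if_true]

/-! ### `Σ_{(e,m)=1} μ(e) e⁻²` -/

/-- The term `[(e,m)=1] μ(e) e⁻²` of `ζ_m(2)/ζ(2) = Σ_{(e,m)=1} μ(e)e⁻²` (4.32). [cite: ConreyIwaniec2002, §4 (4.32)] -/
def msTerm (m e : ℕ) : ℝ := if e.Coprime m then (μ e : ℝ) / (e : ℝ) ^ 2 else 0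

/-- Unfolding lemma for `msTerm` (4.32). [cite: ConreyIwaniec2002, §4 (4.32)] -/
theorem msTerm_def (m e : ℕ) :
    msTerm m e = if e.Coprime m then (μ e : ℝ) / (e : ℝ) ^ 2 else 0 := rfl

/-- `κ(m) = Σ_{e ≥ 1, (e,m)=1} μ(e) e⁻²` (`= ∏_{p ∤ m}(1 − p⁻²)`; for `m = q` this is print's
`ζ_q(2)/ζ(2)` in (4.32)). The term `e = 0` vanishes (`μ(0) = 0`). [cite: ConreyIwaniec2002, §4 (4.32)] -/
def moebiusSqSum (m : ℕ) : ℝ := ∑' e : ℕ, msTerm m e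

/-- `|μ(e)| ≤ 1` in `ℝ` (cf. the tree's `abs_moebius_real_le_one`, not imported here). [folklore] -/
private theorem abs_moebius_cast_le_one (e : ℕ) : |(μ e : ℝ)| ≤ 1 := by
  have h := abs_moebius_le_one (n := e)
  exact_mod_cast h

/-- The terms of `moebiusSqSum` are bounded by `e⁻²`. [folklore] -/
private theorem abs_msTerm_le (m e : ℕ) : |msTerm m e| ≤ 1 / (e : ℝ) ^ 2 := by
  rw [msTerm_def]
  split_ifs with h
  · rw [abs_div, abs_of_nonneg (by positivity : (0 : ℝ) ≤ (e : ℝ) ^ 2)]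
    exact div_le_div_of_nonneg_right (abs_moebius_cast_le_one e) (by positivity)
  · rw [abs_zero]; positivity

/-- The series `Σ_{(e,m)=1} μ(e)e⁻²` (4.32) converges absolutely. [cite: ConreyIwaniec2002, §4 (4.32)] -/
theorem summable_msTerm (m : ℕ) : Summable (msTerm m) := by
  refine Summable.of_norm_bounded (g := fun e : ℕ ↦ 1 / (e : ℝ) ^ 2)
    (Real.summable_one_div_nat_pow.mpr one_lt_two) fun e ↦ ?_
  rw [Real.norm_eq_abs]
  exact abs_msTerm_le m e

/-- `μ(pe) = −μ(e)` if `p ∤ e`, and `μ(pe) = 0` if `p ∣ e`. [folklore] -/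
private theorem moebius_prime_mul {p : ℕ} (hp : p.Prime) (e : ℕ) :
    (μ (p * e) : ℝ) = if p ∣ e then 0 else -(μ e : ℝ) := by
  split_ifs with h
  · have hns : ¬ Squarefree (p * e) := by
      obtain ⟨k, rfl⟩ := h
      intro hsq
      have hu : IsUnit p := hsq p ⟨k, by ring⟩
      exact hp.ne_one (Nat.isUnit_iff.mp hu)
    have h0 : μ (p * e) = 0 := by
      by_contra hne
      exact hns (moebius_ne_zero_iff_squarefree.mp hne)
    rw [h0, Int.cast_zero]
  · have hcop : p.Coprime e := hp.coprime_iff_not_dvd.mpr h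
    rw [isMultiplicative_moebius.map_mul_of_coprime hcop, moebius_apply_prime hp]
    push_cast
    ring

/-- For a prime `p ∣ e`, `e` is not coprime to `mp`. [folklore] -/
private theorem not_coprime_mul_of_dvd {p m e : ℕ} (hp : p.Prime) (hpe : p ∣ e) : ¬ e.Coprime (m * p) := by
  intro hc
  have h1 : p.Coprime p :=
    Nat.Coprime.coprime_dvd_left hpe (Nat.Coprime.coprime_mul_left_right hc)
  exact hp.ne_one ((Nat.coprime_self p).mp h1)

/-- For a prime `p ∤ e`: `(e, mp) = 1 ↔ (e, m) = 1`. [folklore] -/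
private theorem coprime_mul_prime_iff {p m e : ℕ} (hp : p.Prime) (hpe : ¬ p ∣ e) :
    e.Coprime (m * p) ↔ e.Coprime m := by
  constructor
  · exact fun h ↦ Nat.Coprime.coprime_mul_right_right h
  · intro h
    exact Nat.Coprime.mul_right h ((Nat.Prime.coprime_iff_not_dvd hp).mpr hpe).symm

/-- **Removing one Euler factor**: for a prime `p ∤ m`,
`Σ_{(e,m)=1} μ(e)e⁻² = (1 − p⁻²) Σ_{(e,mp)=1} μ(e)e⁻²` (the Euler factors of `ζ_q(2)/ζ(2)`, (4.32)).
[cite: ConreyIwaniec2002, §4 (4.32)] -/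
theorem moebiusSqSum_eq_mul_prime (m : ℕ) {p : ℕ} (hp : p.Prime) (hpm : ¬ p ∣ m) :
    moebiusSqSum m = (1 - 1 / (p : ℝ) ^ 2) * moebiusSqSum (m * p) := by
  have hp0 : (p : ℝ) ≠ 0 := by exact_mod_cast hp.ne_zero
  -- split `(e, m) = 1` according to `p ∣ e`
  have hsplit : ∀ e : ℕ, msTerm m e = msTerm (m * p) e + (if p ∣ e then msTerm m e else 0) := by
    intro e
    by_cases hpe : p ∣ e
    · rw [if_pos hpe, msTerm_def (m * p), if_neg (not_coprime_mul_of_dvd hp hpe), zero_add]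
    · rw [if_neg hpe, add_zero, msTerm_def, msTerm_def]
      by_cases hc : e.Coprime m
      · rw [if_pos hc, if_pos ((coprime_mul_prime_iff hp hpe).mpr hc)]
      · rw [if_neg hc, if_neg (fun h ↦ hc ((coprime_mul_prime_iff hp hpe).mp h))]
  -- the `p ∣ e` part, reindexed by `e = p e'`, is `−p⁻² Σ_{(e',mp)=1} μ(e') e'⁻²`
  have hshift : ∀ e : ℕ, msTerm m (p * e) = -(1 / (p : ℝ) ^ 2) * msTerm (m * p) e := by
    intro e
    rw [msTerm_def, msTerm_def, moebius_prime_mul hp]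
    by_cases hpe : p ∣ e
    · rw [if_pos hpe, if_neg (not_coprime_mul_of_dvd hp hpe)]
      simp
    · rw [if_neg hpe]
      have hiff : (p * e).Coprime m ↔ e.Coprime m := by
        rw [Nat.coprime_mul_iff_left]
        exact ⟨fun h ↦ h.2, fun h ↦ ⟨(Nat.Prime.coprime_iff_not_dvd hp).mpr hpm, h⟩⟩
      by_cases hc : e.Coprime m
      · rw [if_pos (hiff.mpr hc), if_pos ((coprime_mul_prime_iff hp hpe).mpr hc)]
        push_cast
        by_cases he : (e : ℝ) = 0
        · rw [he]; simp
        · field_simp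
      · rw [if_neg (fun h ↦ hc (hiff.mp h)),
          if_neg (fun h ↦ hc ((coprime_mul_prime_iff hp hpe).mp h))]
        simp
  have hsum1 : Summable (msTerm (m * p)) := summable_msTerm _
  have hsum2 : Summable (fun e : ℕ ↦ if p ∣ e then msTerm m e else 0) := by
    refine Summable.of_norm_bounded (g := fun e : ℕ ↦ 1 / (e : ℝ) ^ 2)
      (Real.summable_one_div_nat_pow.mpr one_lt_two) fun e ↦ ?_
    rw [Real.norm_eq_abs]
    split_ifs
    · exact abs_msTerm_le m e
    · rw [abs_zero]; positivity
  calc moebiusSqSum m = ∑' e : ℕ, (msTerm (m * p) e + (if p ∣ e then msTerm m e else 0)) :=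
        tsum_congr hsplit
    _ = moebiusSqSum (m * p) + ∑' e : ℕ, (if p ∣ e then msTerm m e else 0) :=
        hsum1.tsum_add hsum2
    _ = moebiusSqSum (m * p) + ∑' e : ℕ, msTerm m (p * e) := by
        rw [tsum_ite_dvd_eq p hp.ne_zero]
    _ = moebiusSqSum (m * p) + (-(1 / (p : ℝ) ^ 2)) * moebiusSqSum (m * p) := by
        rw [tsum_congr hshift, tsum_mul_left]; rfl
    _ = (1 - 1 / (p : ℝ) ^ 2) * moebiusSqSum (m * p) := by ring

/-- **Removing the Euler factors at a finite set of primes**: for distinct primes `S`, none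
dividing `m`, `Σ_{(e,m)=1} μ(e)e⁻² = ∏_{p∈S}(1 − p⁻²) · Σ_{(e, m∏S)=1} μ(e)e⁻²` ((4.32)).
[cite: ConreyIwaniec2002, §4 (4.32)] -/
theorem moebiusSqSum_eq_prod_mul (m : ℕ) (S : Finset ℕ) (hS : ∀ p ∈ S, p.Prime)
    (hSm : ∀ p ∈ S, ¬ p ∣ m) :
    moebiusSqSum m = (∏ p ∈ S, (1 - 1 / (p : ℝ) ^ 2)) * moebiusSqSum (m * ∏ p ∈ S, p) := by
  classical
  induction S using Finset.induction_on with
  | empty => simp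
  | insert p S hpS ih =>
    have hp : p.Prime := hS p (Finset.mem_insert_self p S)
    have hS' : ∀ r ∈ S, r.Prime := fun r hr ↦ hS r (Finset.mem_insert_of_mem hr)
    have hSm' : ∀ r ∈ S, ¬ r ∣ m := fun r hr ↦ hSm r (Finset.mem_insert_of_mem hr)
    rw [Finset.prod_insert hpS, Finset.prod_insert hpS, ih hS' hSm']
    -- `p ∤ m ∏_{S} r`
    have hpdvd : ¬ p ∣ m * ∏ r ∈ S, r := by
      intro h
      rcases (Nat.Prime.dvd_mul hp).mp h with h1 | h2
      · exact hSm p (Finset.mem_insert_self p S) h1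
      · obtain ⟨r, hr, hpr⟩ := (Prime.dvd_finsetProd_iff hp.prime _).mp h2
        have : p = r := (Nat.prime_dvd_prime_iff_eq hp (hS' r hr)).mp hpr
        exact hpS (this ▸ hr)
    rw [moebiusSqSum_eq_mul_prime _ hp hpdvd,
      show m * ((p : ℕ) * ∏ r ∈ S, r) = m * (∏ r ∈ S, r) * p by ring]
    ring

/-- For a squarefree `q` and `a ∣ q`: `Σ_{(e,q/a)=1} μ(e)e⁻² = ∏_{p∣a}(1 − p⁻²)·Σ_{(e,q)=1} μ(e)e⁻²`
(`ζ_{q/a}(2)/ζ(2)` versus `ζ_q(2)/ζ(2)`, (4.32)). [cite: ConreyIwaniec2002, §4 (4.32)] -/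
theorem moebiusSqSum_div_eq {q a : ℕ} (hq : Squarefree q) (ha : a ∣ q) :
    moebiusSqSum (q / a) = (∏ p ∈ a.primeFactors, (1 - 1 / (p : ℝ) ^ 2)) * moebiusSqSum q := by
  have hq0 : q ≠ 0 := hq.ne_zero
  have haq : a * (q / a) = q := Nat.mul_div_cancel' ha
  have hasq : Squarefree a := hq.squarefree_of_dvd ha
  have hcop : a.Coprime (q / a) := Nat.coprime_of_squarefree_mul (haq.symm ▸ hq)
  have h := moebiusSqSum_eq_prod_mul (q / a) a.primeFactors
    (fun p hp ↦ Nat.prime_of_mem_primeFactors hp) (fun p hp hdvd ↦ by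
      have hpa : p ∣ a := Nat.dvd_of_mem_primeFactors hp
      have hp1 : p = 1 := Nat.eq_one_of_dvd_coprimes hcop hpa hdvd
      exact (Nat.prime_of_mem_primeFactors hp).ne_one hp1)
  rwa [Nat.prod_primeFactors_of_squarefree hasq, mul_comm (q / a) a, haq] at h

/-! ### `0 ≤ Σ_{(e,m)=1} μ(e)e⁻² ≤ 1` for odd `m` -/

/-- The head `e < 5` of the series: `1 − 1/4 + [3 ∤ m](−1/9) + 0`. [folklore] -/
private theorem sum_range_five_msTerm {m : ℕ} (hm : Odd m) :
    ∑ e ∈ Finset.range 5, msTerm m e =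
      3 / 4 + (if (3 : ℕ).Coprime m then -(1 / 9 : ℝ) else 0) := by
  have h2 : (2 : ℕ).Coprime m := Nat.coprime_two_left.mpr hm
  have hμ2 : (μ 2 : ℝ) = -1 := by
    rw [moebius_apply_prime Nat.prime_two]; push_cast; ring
  have hμ3 : (μ 3 : ℝ) = -1 := by
    rw [moebius_apply_prime Nat.prime_three]; push_cast; ring
  have hμ4 : (μ 4 : ℝ) = 0 := by
    rw [show (4 : ℕ) = 2 ^ 2 by norm_num, moebius_apply_prime_pow Nat.prime_two (by norm_num)]
    simp
  simp only [Finset.sum_range_succ, Finset.sum_range_zero, msTerm_def, zero_add]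
  rw [if_pos (Nat.coprime_one_left m), if_pos h2, ArithmeticFunction.moebius_apply_one]
  have h0 : (if (0 : ℕ).Coprime m then (μ 0 : ℝ) / ((0 : ℕ) : ℝ) ^ 2 else 0) = 0 := by
    split_ifs <;> simp
  rw [h0, hμ2]
  have h4 : (if (4 : ℕ).Coprime m then (μ 4 : ℝ) / ((4 : ℕ) : ℝ) ^ 2 else 0) = 0 := by
    split_ifs <;> simp [hμ4]
  rw [h4]
  split_ifs with h3
  · rw [hμ3]; push_cast; ring
  · push_cast; ring

/-- The tail `Σ_{e ≥ 5} e⁻² < 1/4` (from `ζ(2) = π²/6` and `π < 3.15`). [folklore] -/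
private theorem tsum_inv_sq_add_five_lt : ∑' e : ℕ, 1 / ((e + 5 : ℕ) : ℝ) ^ 2 < 1 / 4 := by
  have h := (hasSum_nat_add_iff' 5).mpr hasSum_zeta_two
  rw [h.tsum_eq]
  simp only [Finset.sum_range_succ, Finset.sum_range_zero, Nat.cast_zero, Nat.cast_one,
    Nat.cast_ofNat, zero_add]
  have hpi : Real.pi ^ 2 < 3.15 ^ 2 := by
    have := Real.pi_lt_d2
    have h0 : 0 < Real.pi := Real.pi_pos
    nlinarith
  norm_num
  nlinarith

/-- The tail of `moebiusSqSum` beyond `e = 5` is at most `Σ_{e≥5} e⁻² < 1/4` in absolute value.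
[folklore] -/
private theorem abs_tsum_msTerm_add_five_le (m : ℕ) :
    |∑' e : ℕ, msTerm m (e + 5)| ≤ ∑' e : ℕ, 1 / ((e + 5 : ℕ) : ℝ) ^ 2 := by
  have hsum : Summable (fun e : ℕ ↦ 1 / ((e + 5 : ℕ) : ℝ) ^ 2) :=
    ((hasSum_nat_add_iff' 5).mpr hasSum_zeta_two).summable
  have h := tsum_of_norm_bounded hsum.hasSum (f := fun e : ℕ ↦ msTerm m (e + 5))
    (fun e ↦ by rw [Real.norm_eq_abs]; exact abs_msTerm_le m (e + 5))
  rwa [Real.norm_eq_abs] at h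

/-- **`0 ≤ Σ_{(e,m)=1} μ(e)e⁻²`** for odd `m` (`κ = ζ_q(2)/ζ(2) ≥ 0` in (4.32)/(6.24)).
[cite: ConreyIwaniec2002, §4 (4.32), §6 (6.24)] -/
theorem moebiusSqSum_nonneg {m : ℕ} (hm : Odd m) : 0 ≤ moebiusSqSum m := by
  have hsplit := (summable_msTerm m).sum_add_tsum_nat_add 5
  rw [moebiusSqSum, ← hsplit, sum_range_five_msTerm hm]
  have htail := abs_tsum_msTerm_add_five_le m
  have hlt := tsum_inv_sq_add_five_lt
  have h1 := neg_abs_le (∑' e : ℕ, msTerm m (e + 5))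
  split_ifs <;> linarith

/-- **`Σ_{(e,m)=1} μ(e)e⁻² ≤ 1`** for odd `m` (`κ = ζ_q(2)/ζ(2) ≤ 1` in (4.32)/(6.24)).
[cite: ConreyIwaniec2002, §4 (4.32), §6 (6.24)] -/
theorem moebiusSqSum_le_one {m : ℕ} (hm : Odd m) : moebiusSqSum m ≤ 1 := by
  have hsplit := (summable_msTerm m).sum_add_tsum_nat_add 5
  rw [moebiusSqSum, ← hsplit, sum_range_five_msTerm hm]
  have htail := abs_tsum_msTerm_add_five_le m
  have hlt := tsum_inv_sq_add_five_lt
  have h1 := le_abs_self (∑' e : ℕ, msTerm m (e + 5))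
  split_ifs <;> linarith

/-! ### Möbius values on squarefree numbers -/

/-- `μ(ne) = μ(n)μ(e)` if `(n,e) = 1` and `μ(ne) = 0` otherwise (the step `μ(v ℓ/(h,v))` of (4.29)–(4.31)).
[cite: ConreyIwaniec2002, §4 (4.29)–(4.31)] -/
theorem moebius_mul_eq {n : ℕ} (e : ℕ) :
    (μ (n * e) : ℝ) = if n.Coprime e then (μ n : ℝ) * μ e else 0 := by
  split_ifs with h
  · rw [isMultiplicative_moebius.map_mul_of_coprime h]; push_cast; ring
  · have hns : ¬ Squarefree (n * e) := fun hsq ↦ h (Nat.coprime_of_squarefree_mul hsq)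
    have h0 : μ (n * e) = 0 := by
      by_contra hne
      exact hns (moebius_ne_zero_iff_squarefree.mp hne)
    rw [h0, Int.cast_zero]

/-- For squarefree `v` and `a ∣ v`: `μ(v) μ(a) = μ(v/a)` (the sign `μ(v/(h,v))` of (4.31)).
[cite: ConreyIwaniec2002, §4 (4.31)] -/
theorem moebius_mul_moebius_of_dvd {v a : ℕ} (hv : Squarefree v) (ha : a ∣ v) :
    (μ v : ℝ) * μ a = μ (v / a) := by
  have hav : a * (v / a) = v := Nat.mul_div_cancel' ha
  have hasq : Squarefree a := hv.squarefree_of_dvd ha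
  have hcop : a.Coprime (v / a) := Nat.coprime_of_squarefree_mul (hav.symm ▸ hv)
  have h1 : (μ v : ℝ) = μ a * μ (v / a) := by
    rw [← hav, isMultiplicative_moebius.map_mul_of_coprime hcop, hav]; push_cast; ring
  have h2 : (μ a : ℝ) * μ a = 1 := by
    have := moebius_sq_eq_one_of_squarefree hasq
    rw [sq] at this
    exact_mod_cast this
  rw [h1, mul_comm ((μ a : ℝ)) _, mul_assoc, h2, mul_one]

/-- For squarefree `a`: `μ(a) = (−1)^{ω(a)}` with `ω(a) = #a.primeFactors`. [folklore] -/
private theorem moebius_cast_eq_neg_one_pow {a : ℕ} (ha : Squarefree a) :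
    (μ a : ℝ) = (-1) ^ a.primeFactors.card := by
  rw [moebius_apply_of_squarefree ha,
    ← (cardDistinctFactors_eq_cardFactors_iff_squarefree ha.ne_zero).mpr ha,
    cardDistinctFactors_apply, ← List.card_toFinset, Nat.primeFactors]
  push_cast
  ring

/-- For squarefree `a`: `∏_{p∣a}(1 − p²) = μ(a) a² ∏_{p∣a}(1 − p⁻²)` (the passage (4.31) → (4.32)).
[cite: ConreyIwaniec2002, §4 (4.31)–(4.32)] -/
theorem prod_one_sub_sq_eq {a : ℕ} (ha : Squarefree a) :
    ∏ p ∈ a.primeFactors, (1 - (p : ℝ) ^ 2) =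
      (μ a : ℝ) * (a : ℝ) ^ 2 * ∏ p ∈ a.primeFactors, (1 - 1 / (p : ℝ) ^ 2) := by
  have hterm : ∀ p ∈ a.primeFactors,
      (1 - (p : ℝ) ^ 2) = (-1) * (p : ℝ) ^ 2 * (1 - 1 / (p : ℝ) ^ 2) := by
    intro p hp
    have hp0 : (p : ℝ) ≠ 0 := by exact_mod_cast (Nat.prime_of_mem_primeFactors hp).ne_zero
    field_simp
    ring
  rw [Finset.prod_congr rfl hterm, Finset.prod_mul_distrib, Finset.prod_mul_distrib,
    Finset.prod_const, Finset.prod_pow, ← Nat.cast_prod, Nat.prod_primeFactors_of_squarefree ha,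
    moebius_cast_eq_neg_one_pow ha]

/-! ### The arithmetic functions `j_w`, `k_v`, `m_{v,w} = ζ * j_w * k_v` and the series `Σ_{(c,q)=v} r_c(h)c⁻²` (definitions) -/

/-- `j_w(n) = [(n,w) = 1]·n⁻¹` (value `0` at `n = 0`). [cite: ConreyIwaniec2002, §4 (4.31)–(4.34)] -/
def jFun (w : ℕ) : ArithmeticFunction ℝ :=
  ⟨fun n ↦ if n.Coprime w then (n : ℝ)⁻¹ else 0, by simp⟩

/-- Unfolding lemma for `jFun` ((4.31)–(4.34)). [cite: ConreyIwaniec2002, §4 (4.31)–(4.34)] -/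
theorem jFun_apply (w n : ℕ) : jFun w n = if n.Coprime w then (n : ℝ)⁻¹ else 0 := rfl

/-- `k_v(n) = [n ∣ v]·μ(n)·n` (value `0` at `n = 0` for `v ≠ 0`). [cite: ConreyIwaniec2002, §4 (4.34)] -/
def kFun (v : ℕ) : ArithmeticFunction ℝ :=
  ⟨fun n ↦ if n ∣ v then (μ n : ℝ) * n else 0, by simp⟩

/-- Unfolding lemma for `kFun` ((4.34)). [cite: ConreyIwaniec2002, §4 (4.34)] -/
theorem kFun_apply (v n : ℕ) : kFun v n = if n ∣ v then (μ n : ℝ) * n else 0 := rfl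

/-- `m_{v,w} = ζ * j_w * k_v`: `m_{v,w}(h) = Σ_{d ∣ h} (j_w * k_v)(d)`; for squarefree `q = vw`
this is `v²/(κ μ(v))` times `Σ_{(c,q)=v} r_c(h) c⁻²` (`rcSum_eq`). [cite: ConreyIwaniec2002, §4 (4.31)–(4.32)] -/
def mFun (v w : ℕ) : ArithmeticFunction ℝ := (ζ : ArithmeticFunction ℝ) * (jFun w * kFun v)

/-- `m_{v,w}(h) = Σ_{d ∣ h} (j_w * k_v)(d)` ((4.31)). [cite: ConreyIwaniec2002, §4 (4.31)–(4.32)] -/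
theorem mFun_apply (v w h : ℕ) : mFun v w h = ∑ d ∈ h.divisors, (jFun w * kFun v) d := by
  rw [mFun, coe_zeta_mul_apply]

/-- **`Σ_{c ≥ 1, (c,q)=v} r_c(h) c⁻²`** as a series over `c : ℕ` (the term `c = 0` vanishes),
`r_c(h)` in Kluyver's form `Σ_{d ∣ (c,h)} d μ(c/d)` (the tree's `ramanujanDivisorSum`, equal to the
Ramanujan sum by `ramanujanSum_eq_ramanujanDivisorSum`). This is the series of (4.27).
[cite: ConreyIwaniec2002, §4 (4.27)–(4.28)] -/
def rcSum (q v h : ℕ) : ℝ :=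
  ∑' c : ℕ, if Nat.gcd c q = v then (ramanujanDivisorSum h c : ℝ) / (c : ℝ) ^ 2 else 0

end SigmaGenus

end ConreyIwaniec2002

end Literature.NumberTheory.LFunctions

end
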